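import Summits.NavierStokesRegularity.NavierStokesRegularity.Theses.RellichScar
import Summits.NavierStokesRegularity.NavierStokesRegularity.Theorems.ScarRigidity.Negative.LogicAndLoadBearing
import Literature.Analysis.FluidPDE.TypeIAncientMild
import Literature.Analysis.FluidPDE.ParasiticSlabFlow
import Literature.Analysis.FluidPDE.WholeSpaceIBPIntegrable
import HarnessLib

/-!
# `ScarRigidity` — line `finite-energy-log-convexity`, stub `stub_logConvexityBelowThreshold`:
# the pairing bound for the linearised convection (crux stmt-NavierStokesRegularity-11717)

Helper file 4 of S4 (`stub_logConvexityBelowThreshold`). In the Agmon–Nirenberg frame for the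
difference `w = V₁ - V₂` of two apex profiles the forcing is the linearised convection
`B = (w·∇)V₁ + (V₂·∇)w = ∇·(w ⊗ V₁ + V₂ ⊗ w)` (`div w = div V₂ = 0`), and the only estimate the
frame needs is the **pairing bound**

  `|∫ ⟪B, φ⟫| ≤ 2M ‖w‖_{L²} ‖Dφ‖_{L²}`,  `M = sup (‖V₁‖, ‖V₂‖) = C/√(-t)`,

against the two test fields `φ = w - λψ` (`ψ = (-Δ)⁻¹ w`), obtained by moving the derivative
onto `φ`: `∫ ⟪(w·∇)V₁, φ⟫ = -∫ ⟪V₁, (w·∇)φ⟫`, `∫ ⟪(V₂·∇)w, φ⟫ = -∫ ⟪w, (V₂·∇)φ⟫` (whole-space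
integration by parts for divergence-free transport fields under `L¹` hypotheses, no compact
support), then `|⟪V₁, Dφ(w)⟫| + |⟪w, Dφ(V₂)⟫| ≤ 2M ‖w‖ ‖Dφ‖` and Cauchy–Schwarz.

* `integral_inner_convect_add_eq_zero_of_integrable` — the trilinear identity
  `∫ ⟪(u·∇)v, φ⟫ + ∫ ⟪v, (u·∇)φ⟫ + ∫ ⟪v, φ⟫ div u = 0` under `L¹` hypotheses (the tree's
  `integral_mul_divergence_add_eq_zero_of_integrable` applied to `θ = ⟪v, φ⟫`; the compact-support
  form is `integral_inner_convect_add_eq_zero`, `WholeSpaceIBP`);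
* `integral_inner_convect_eq_neg_of_isDivFree` — its divergence-free case;
* `integral_mul_le_sqrt_mul_sqrt` — Cauchy–Schwarz in `L²` in square-root form;
* `abs_integral_inner_linConvect_le` — the pairing bound.

References: Leray 1934, §6 (1.11) (integration by parts on the whole space); Majda–Bertozzi
2002, §1.2 (the trilinear identity); Agmon–Nirenberg 1967 (the frame).
-/

noncomputable section

open Set Filter Function MeasureTheory Metric TopologicalSpace
open scoped Topology ENNReal NNReal InnerProductSpace RealInnerProductSpace
open Literature.Analysis.FluidPDE
open Summit.NavierStokesRegularity.NavierStokesRegularity.Theses.RellichScar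
open Summit.NavierStokesRegularity.NavierStokesRegularity.Theorems.ScarRigidity.Negative

set_option linter.dupNamespace false

namespace Summit.NavierStokesRegularity.NavierStokesRegularity.Theorems.RellichScarScarRigidity

variable {E : Type*} [NormedAddCommGroup E] [InnerProductSpace ℝ E] [FiniteDimensional ℝ E]
  [MeasurableSpace E] [BorelSpace E]
variable {F' : Type*} [NormedAddCommGroup F'] [InnerProductSpace ℝ F']

/-! ## The trilinear identity under `L¹` hypotheses -/

/-- **Trilinear convection identity, `L¹` form.** For `C¹` fields `u : E → E`, `v, φ : E → F'`
with `⟪v, φ⟫ u`, `⟪(u·∇)v, φ⟫`, `⟪v, (u·∇)φ⟫` and `⟪v, φ⟫ div u` integrable,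
`∫ ⟪(u·∇)v, φ⟫ + ∫ ⟪v, (u·∇)φ⟫ + ∫ ⟪v, φ⟫ div u = 0`
(`div (⟪v,φ⟫ u) = ⟪v,φ⟫ div u + ⟪(u·∇)v, φ⟫ + ⟪v, (u·∇)φ⟫` and `∫ div = 0` for integrable fields
with integrable divergence; Leray 1934 §6 (1.11), Majda–Bertozzi §1.2). [cite: Leray1934, §6 (1.11) p. 203] -/
theorem integral_inner_convect_add_eq_zero_of_integrable {u : E → E} {v φ : E → F'}
    (hu : ContDiff ℝ 1 u) (hv : ContDiff ℝ 1 v) (hφ : ContDiff ℝ 1 φ)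
    (h0 : Integrable (fun x => ⟪v x, φ x⟫ • u x))
    (h1 : Integrable (fun x => ⟪convect u v x, φ x⟫))
    (h2 : Integrable (fun x => ⟪v x, convect u φ x⟫))
    (h3 : Integrable (fun x => ⟪v x, φ x⟫ * VectorCalculus.divergence u x)) :
    (∫ x, ⟪convect u v x, φ x⟫) + (∫ x, ⟪v x, convect u φ x⟫) +
      ∫ x, ⟪v x, φ x⟫ * VectorCalculus.divergence u x = 0 := by
  have hθ : ContDiff ℝ 1 fun x => ⟪v x, φ x⟫ := hv.inner ℝ hφ
  have hgrad : ∀ x, ⟪u x, gradient (fun y => ⟪v y, φ y⟫) x⟫ =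
      ⟪convect u v x, φ x⟫ + ⟪v x, convect u φ x⟫ := fun x => by
    rw [gradient, real_inner_comm, InnerProductSpace.toDual_symm_apply,
      fderiv_inner_apply ℝ (hv.differentiable one_ne_zero x) (hφ.differentiable one_ne_zero x)]
    simp [convect, add_comm]
  have h12 : Integrable (fun x => ⟪u x, gradient (fun y => ⟪v y, φ y⟫) x⟫) := by
    simp_rw [hgrad]; exact h1.add h2
  have h := integral_mul_divergence_add_eq_zero_of_integrable hθ hu h0 h3 h12
  simp_rw [hgrad] at h
  rw [integral_add h1 h2] at h
  linarith

/-- **Divergence-free transport**: for `div u = 0`,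
`∫ ⟪(u·∇)v, φ⟫ = -∫ ⟪v, (u·∇)φ⟫` under the `L¹` hypotheses of
`integral_inner_convect_add_eq_zero_of_integrable`. [folklore] -/
theorem integral_inner_convect_eq_neg_of_isDivFree {u : E → E} {v φ : E → F'}
    (hu : ContDiff ℝ 1 u) (hv : ContDiff ℝ 1 v) (hφ : ContDiff ℝ 1 φ)
    (hdiv : VectorCalculus.IsDivFree u)
    (h0 : Integrable (fun x => ⟪v x, φ x⟫ • u x))
    (h1 : Integrable (fun x => ⟪convect u v x, φ x⟫))
    (h2 : Integrable (fun x => ⟪v x, convect u φ x⟫)) :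
    ∫ x, ⟪convect u v x, φ x⟫ = -∫ x, ⟪v x, convect u φ x⟫ := by
  have h3 : Integrable (fun x => ⟪v x, φ x⟫ * VectorCalculus.divergence u x) := by
    have : (fun x => ⟪v x, φ x⟫ * VectorCalculus.divergence u x) = fun _ => 0 := by
      funext x; rw [hdiv x, mul_zero]
    rw [this]; exact integrable_zero _ _ _
  have h := integral_inner_convect_add_eq_zero_of_integrable hu hv hφ h0 h1 h2 h3
  have hz : ∫ x, ⟪v x, φ x⟫ * VectorCalculus.divergence u x = 0 := by
    simp_rw [hdiv _, mul_zero, integral_zero]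
  linarith

/-! ## Cauchy–Schwarz in `L²` -/

/-- Cauchy–Schwarz in `L²` for non-negative functions, square-root form:
`∫ f g ≤ √(∫ f²) √(∫ g²)` (Mathlib's Hölder inequality `integral_mul_le_Lp_mul_Lq_of_nonneg`
at `p = q = 2`). [folklore] -/
theorem integral_mul_le_sqrt_mul_sqrt {f g : E → ℝ} (hf0 : ∀ x, 0 ≤ f x) (hg0 : ∀ x, 0 ≤ g x)
    (hfm : AEStronglyMeasurable f volume) (hgm : AEStronglyMeasurable g volume)
    (hf : Integrable (fun x => f x ^ 2)) (hg : Integrable (fun x => g x ^ 2)) :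
    ∫ x, f x * g x ≤ Real.sqrt (∫ x, f x ^ 2) * Real.sqrt (∫ x, g x ^ 2) := by
  have hf2 : MemLp f (ENNReal.ofReal 2) volume := by
    rw [ENNReal.ofReal_ofNat]; exact (memLp_two_iff_integrable_sq hfm).2 hf
  have hg2 : MemLp g (ENNReal.ofReal 2) volume := by
    rw [ENNReal.ofReal_ofNat]; exact (memLp_two_iff_integrable_sq hgm).2 hg
  have h := integral_mul_le_Lp_mul_Lq_of_nonneg Real.HolderConjugate.two_two (ae_of_all _ hf0)
    (ae_of_all _ hg0) hf2 hg2
  simp only [Real.rpow_two] at h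
  rwa [Real.sqrt_eq_rpow, Real.sqrt_eq_rpow]

/-! ## The pairing bound -/

/-- **The pairing bound for the linearised convection.** For `C¹` fields `V₁, V₂, w, φ : E → E`
with `div w = div V₂ = 0`, `‖V₁‖, ‖V₂‖ ≤ M`, the `L¹` hypotheses of the two integrations by parts,
and `‖w‖², ‖Dφ‖² ∈ L¹`:
`|∫ ⟪(w·∇)V₁ + (V₂·∇)w, φ⟫| ≤ 2M √(∫ ‖w‖²) √(∫ ‖Dφ‖²)`
(`∫ ⟪B, φ⟫ = -∫ ⟪V₁, Dφ(w)⟫ - ∫ ⟪w, Dφ(V₂)⟫`, then Cauchy–Schwarz). In S4: `M = C/√(-t)`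
(`HasTypeIDecay`), i.e. `‖ℙ∇·(w⊗V₁ + V₂⊗w)‖_{Ḣ⁻¹} ≤ (2C/√(-t)) ‖w‖_{L²}`. [folklore] -/
theorem abs_integral_inner_linConvect_le {V₁ V₂ w φ : E → E} {M : ℝ}
    (hV₁ : ContDiff ℝ 1 V₁) (hV₂ : ContDiff ℝ 1 V₂) (hw : ContDiff ℝ 1 w) (hφ : ContDiff ℝ 1 φ)
    (hdw : VectorCalculus.IsDivFree w) (hdV₂ : VectorCalculus.IsDivFree V₂)
    (hM₁ : ∀ x, ‖V₁ x‖ ≤ M) (hM₂ : ∀ x, ‖V₂ x‖ ≤ M)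
    (h0 : Integrable (fun x => ⟪V₁ x, φ x⟫ • w x))
    (h1 : Integrable (fun x => ⟪convect w V₁ x, φ x⟫))
    (h2 : Integrable (fun x => ⟪V₁ x, convect w φ x⟫))
    (h0' : Integrable (fun x => ⟪w x, φ x⟫ • V₂ x))
    (h1' : Integrable (fun x => ⟪convect V₂ w x, φ x⟫))
    (h2' : Integrable (fun x => ⟪w x, convect V₂ φ x⟫))
    (hw2 : Integrable (fun x => ‖w x‖ ^ 2)) (hφ2 : Integrable (fun x => ‖fderiv ℝ φ x‖ ^ 2)) :
    |∫ x, ⟪convect w V₁ x + convect V₂ w x, φ x⟫| ≤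
      2 * M * Real.sqrt (∫ x, ‖w x‖ ^ 2) * Real.sqrt (∫ x, ‖fderiv ℝ φ x‖ ^ 2) := by
  have hM : 0 ≤ M := (norm_nonneg _).trans (hM₁ 0)
  -- integrate by parts
  have e1 := integral_inner_convect_eq_neg_of_isDivFree hw hV₁ hφ hdw h0 h1 h2
  have e2 := integral_inner_convect_eq_neg_of_isDivFree hV₂ hw hφ hdV₂ h0' h1' h2'
  have hsplit : ∫ x, ⟪convect w V₁ x + convect V₂ w x, φ x⟫ =
      -((∫ x, ⟪V₁ x, convect w φ x⟫) + ∫ x, ⟪w x, convect V₂ φ x⟫) := by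
    simp_rw [inner_add_left]
    rw [integral_add h1 h1', e1, e2]
    ring
  rw [hsplit, abs_neg]
  -- pointwise bound of the integrand after integration by parts
  have hpt : ∀ x, |⟪V₁ x, convect w φ x⟫ + ⟪w x, convect V₂ φ x⟫| ≤
      2 * M * (‖w x‖ * ‖fderiv ℝ φ x‖) := by
    intro x
    have a1 : |⟪V₁ x, convect w φ x⟫| ≤ M * (‖w x‖ * ‖fderiv ℝ φ x‖) := by
      calc |⟪V₁ x, convect w φ x⟫| ≤ ‖V₁ x‖ * ‖convect w φ x‖ := abs_real_inner_le_norm _ _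
        _ ≤ M * (‖fderiv ℝ φ x‖ * ‖w x‖) :=
            mul_le_mul (hM₁ x) (ContinuousLinearMap.le_opNorm _ _) (norm_nonneg _) hM
        _ = M * (‖w x‖ * ‖fderiv ℝ φ x‖) := by ring
    have a2 : |⟪w x, convect V₂ φ x⟫| ≤ M * (‖w x‖ * ‖fderiv ℝ φ x‖) := by
      calc |⟪w x, convect V₂ φ x⟫| ≤ ‖w x‖ * ‖convect V₂ φ x‖ := abs_real_inner_le_norm _ _
        _ ≤ ‖w x‖ * (‖fderiv ℝ φ x‖ * M) :=
            mul_le_mul_of_nonneg_left ((ContinuousLinearMap.le_opNorm _ _).trans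
              (mul_le_mul_of_nonneg_left (hM₂ x) (norm_nonneg _))) (norm_nonneg _)
        _ = M * (‖w x‖ * ‖fderiv ℝ φ x‖) := by ring
    calc |⟪V₁ x, convect w φ x⟫ + ⟪w x, convect V₂ φ x⟫|
        ≤ |⟪V₁ x, convect w φ x⟫| + |⟪w x, convect V₂ φ x⟫| := abs_add_le _ _
      _ ≤ 2 * M * (‖w x‖ * ‖fderiv ℝ φ x‖) := by linarith
  -- Cauchy–Schwarz
  have hwm : AEStronglyMeasurable (fun x => ‖w x‖) volume :=
    hw.continuous.norm.aestronglyMeasurable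
  have hφm : AEStronglyMeasurable (fun x => ‖fderiv ℝ φ x‖) volume :=
    (hφ.continuous_fderiv one_ne_zero).norm.aestronglyMeasurable
  have hcs := integral_mul_le_sqrt_mul_sqrt (fun x => norm_nonneg (w x))
    (fun x => norm_nonneg (fderiv ℝ φ x)) hwm hφm hw2 hφ2
  -- the product `‖w‖ ‖Dφ‖` is integrable (AM–GM)
  have hprod : Integrable (fun x => ‖w x‖ * ‖fderiv ℝ φ x‖) := by
    refine ((hw2.add hφ2).div_const 2).mono' (hwm.mul hφm) (ae_of_all _ fun x => ?_)
    rw [Real.norm_of_nonneg (mul_nonneg (norm_nonneg _) (norm_nonneg _))]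
    simp only [Pi.add_apply]
    nlinarith [sq_nonneg (‖w x‖ - ‖fderiv ℝ φ x‖)]
  calc |(∫ x, ⟪V₁ x, convect w φ x⟫) + ∫ x, ⟪w x, convect V₂ φ x⟫|
      = |∫ x, (⟪V₁ x, convect w φ x⟫ + ⟪w x, convect V₂ φ x⟫)| := by rw [integral_add h2 h2']
    _ ≤ ∫ x, |⟪V₁ x, convect w φ x⟫ + ⟪w x, convect V₂ φ x⟫| := abs_integral_le_integral_abs
    _ ≤ ∫ x, 2 * M * (‖w x‖ * ‖fderiv ℝ φ x‖) :=
        integral_mono_of_nonneg (ae_of_all _ fun x => abs_nonneg _) (hprod.const_mul _)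
          (ae_of_all _ hpt)
    _ = 2 * M * ∫ x, ‖w x‖ * ‖fderiv ℝ φ x‖ := integral_const_mul _ _
    _ ≤ 2 * M * (Real.sqrt (∫ x, ‖w x‖ ^ 2) * Real.sqrt (∫ x, ‖fderiv ℝ φ x‖ ^ 2)) :=
        mul_le_mul_of_nonneg_left hcs (by positivity)
    _ = 2 * M * Real.sqrt (∫ x, ‖w x‖ ^ 2) * Real.sqrt (∫ x, ‖fderiv ℝ φ x‖ ^ 2) := by ring

/-! ## Registered sub-goal (helper stub of `stub_logConvexityBelowThreshold`) -/

/-- **Registered helper stub `stub_linConvectPairingBound`** (crux stmt-NavierStokesRegularity-11717,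
line `finite-energy-log-convexity`, helper of S4): the pairing bound for the linearised
convection on `ℝ³`, as registered. [folklore] -/
theorem stub_linConvectPairingBound :
    ∀ (V₁ V₂ w φ : EuclideanSpace ℝ (Fin 3) → EuclideanSpace ℝ (Fin 3)) (M : ℝ),
      ContDiff ℝ 1 V₁ → ContDiff ℝ 1 V₂ → ContDiff ℝ 1 w → ContDiff ℝ 1 φ →
      VectorCalculus.IsDivFree w → VectorCalculus.IsDivFree V₂ →
      (∀ x, ‖V₁ x‖ ≤ M) → (∀ x, ‖V₂ x‖ ≤ M) →
      Integrable (fun x => ⟪V₁ x, φ x⟫ • w x) volume →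
      Integrable (fun x => ⟪convect w V₁ x, φ x⟫) volume →
      Integrable (fun x => ⟪V₁ x, convect w φ x⟫) volume →
      Integrable (fun x => ⟪w x, φ x⟫ • V₂ x) volume →
      Integrable (fun x => ⟪convect V₂ w x, φ x⟫) volume →
      Integrable (fun x => ⟪w x, convect V₂ φ x⟫) volume →
      Integrable (fun x => ‖w x‖ ^ 2) volume → Integrable (fun x => ‖fderiv ℝ φ x‖ ^ 2) volume →
      |∫ x, ⟪convect w V₁ x + convect V₂ w x, φ x⟫| ≤
        2 * M * Real.sqrt (∫ x, ‖w x‖ ^ 2) * Real.sqrt (∫ x, ‖fderiv ℝ φ x‖ ^ 2) :=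
  fun _V₁ _V₂ _w _φ _M hV₁ hV₂ hw hφ hdw hdV₂ hM₁ hM₂ h0 h1 h2 h0' h1' h2' hw2 hφ2 =>
    abs_integral_inner_linConvect_le hV₁ hV₂ hw hφ hdw hdV₂ hM₁ hM₂ h0 h1 h2 h0' h1' h2' hw2 hφ2

end Summit.NavierStokesRegularity.NavierStokesRegularity.Theorems.RellichScarScarRigidity

end
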